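import Mathlib
import HarnessLib
import Literature.MathematicalPhysics.StatisticalMechanics.RenormalisationMapP2FluctSplit
import Literature.MathematicalPhysics.StatisticalMechanics.StepKernelBoundsABKM

/-!
# `R^{(q)}_{k+1}[P₂(e^{−H},K)(X)]` for the torus data with a step kernel BY PREDICATE: norm bound,
# smoothness, Lipschitz bound and the three-term splitting ([ABKM19] Ch. 9.1, `q ∈ B_κ`)

`RenormalisationMapP2Fluct` (`tayNormLE_fluct_polyP2_abkm`, `contDiff_fluct_polyP2_abkm`,
`tayNormLE_fluct_polyP2_sub_abkm`) and `RenormalisationMapP2FluctSplit`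
(`fluct_polyP2_eq_add_add_rest_abkm`) treat `R_{k+1}` with the step kernel EQUAL to the weight kernel
`𝒞_{k+1}` (`q = 0`).  Of the kernel their proofs use only Lemma 8.4 on arbitrary polymers, the
smoothness of `R_{k+1}F` and integrability along the section — the content of `StepKernelBounds`
(`StepKernelBoundsABKM`).  This file is their `q`-twin for an arbitrary kernel `𝒞q` with
`StepKernelBounds W L k A𝒫' C₂ 𝒞q` relative to the `q = 0` weights (constant `A_𝒫 ↦ A𝒫'`):

* **`tayNormLE_fluct_polyP2_abkm_of_stepKernelBounds`**, `contDiff_fluct_polyP2_abkm_of_stepKernelBounds`,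
  **`tayNormLE_fluct_polyP2_sub_abkm_of_stepKernelBounds`**, **`fluct_polyP2_eq_add_add_rest_abkm_of_stepKernelBounds`**.

The `q = 0` statements are recovered with `AbkmWeightBounds.stepKernelBounds`.  Everything is proved;
no named fact.

## References
* S. Adams, S. Buchholz, R. Kotecký, S. Müller, arXiv:1910.13564, Ch. 9.1 ((9.1)–(9.6)), Lemma 8.4,
  Lemma 7.7 [AdamsBuchholzKoteckyMuller2019].
-/

noncomputable section

namespace Literature.MathematicalPhysics.StatisticalMechanics.GradientRG

open scoped BigOperators Classical
open Finset Matrix MeasureTheory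
open Literature.MathematicalPhysics.StatisticalMechanics.TorusPolymer
  (IsPolymer Separated blocks polys bprod blockOf thicken mem_polys mem_blocks numBlocks isPolymer_blockOf)
open Literature.Barriers.CriticalPhenomena.LongRangePhi4.Polymer (IsConn components)
open Literature.MathematicalPhysics.QuantumFieldTheory

variable {d M : ℕ} [NeZero M]

/-- **`|R_{k+1}P₂(e^{−H},K)(X₂)|_{T_k^{X₂*}, w_{k:k+1}^{X₂}} ≤ b_{P₂}(H,K,X₂) · A_𝒫^{|X₂|_k}`** for every
`k`-polymer `X₂` (`θ̄, λ > 0`; hypotheses of `tayNormLE_polyP2_abkm`): Lemma 9.4 followed by Lemma 8.4 on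
arbitrary polymers. [cite: AdamsBuchholzKoteckyMuller2019, Lemma 9.4 / Lemma 9.7 (R₁) / Lemma 8.4] -/
theorem tayNormLE_fluct_polyP2_abkm_of_stepKernelBounds {L N Mord R n p r₀ : ℕ} {θbar lam μ δ₁ δ₀ A𝒫 A𝒫' C₂ h A : ℝ}
    {𝒞 : ℕ → (Fin d → ZMod M) → ℝ} (hd : 2 ≤ d) (hLodd : Odd L)
    (hM : M = L ^ N) {k : ℕ} (hkN : k + 1 ≤ N)
    {𝒞q : (Fin d → ZMod M) → ℝ} (hS : StepKernelBounds (abkmWeightData L N Mord R θbar (schedDelta δ₀ δ₁ N) 𝒞) L k A𝒫' C₂ 𝒞q) (hp : d / 2 + 1 ≤ p) (hMord : d / 2 + 1 ≤ Mord)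
   
    (hB : AbkmWeightBounds L N Mord R n θbar lam μ δ₁ δ₀ A𝒫 𝒞
      (abkmWeightData L N Mord R θbar (schedDelta δ₀ δ₁ N) 𝒞))
    (hδ₀ : 0 < δ₀) (hδ₁ : 0 < δ₁) (hh : 0 < h) (hh0 : hZeroSq d R δ₀ δ₁ ≤ h ^ 2) (hA : 0 < A)
    {X : Finset (Fin d → ZMod M)} (hX : IsPolymer (L ^ k) X)
    {H : RelevantHamiltonian ℂ d}
    (hH : hamNorm (fieldWt h (L : ℝ) d k) ((L : ℝ) ^ k) (L ^ (d * k)) H ≤ 1 / 8)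
    {K : Finset (Fin d → ZMod M) → ((Fin d → ZMod M) → ℝ) → ℂ} {C : ℝ} (hC : 0 ≤ C)
    (hK : WeakNormLE (abkmNormParams L N Mord R p r₀ h θbar A (schedDelta δ₀ δ₁ N) 𝒞) k K C)
    (hKfac : Factorises (L ^ k) K) (hK0 : ∀ φ, K ∅ φ = 1) (hKd : ∀ Y, ContDiff ℝ r₀ (K Y))
    (hKloc : ∀ Y, IsPolymer (L ^ k) Y → IsConn Y →
      IsGaugeLocal ((abkmNormParams L N Mord R p r₀ h θbar A (schedDelta δ₀ δ₁ N) 𝒞).gauge k Y) (K Y)) :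
    TayNormLE ((abkmNormParams L N Mord R p r₀ h θbar A (schedDelta δ₀ δ₁ N) 𝒞).gauge k X) r₀
      ((abkmWeightData L N Mord R θbar (schedDelta δ₀ δ₁ N) 𝒞).midWeight k X)
      (fluct 𝒞q (polyP2 (L ^ k) H K X))
      ((∑ Y ∈ polys (L ^ k) X, (∏ _B ∈ blocks (L ^ k) (X \ Y),
        8 * Real.exp (1 / 4) * hamNorm (fieldWt h (L : ℝ) d k) ((L : ℝ) ^ k) (L ^ (d * k)) H) *
        ∏ Z ∈ components Y, C * (abkmNormParams L N Mord R p r₀ h θbar A (schedDelta δ₀ δ₁ N) 𝒞).aFactor k Z) *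
        A𝒫' ^ numBlocks (L ^ k) X) := by
  set P := abkmNormParams L N Mord R p r₀ h θbar A (schedDelta δ₀ δ₁ N) 𝒞 with hP
  have hL0 : (0 : ℝ) < L := by exact_mod_cast hLodd.pos
  have hk1 : k + 1 ≤ N + 1 := by omega
  have hP2 := tayNormLE_polyP2_abkm hd hLodd hM hkN hp hMord hB hδ₀ hδ₁ hh hh0 hA hX hH hC hK hKfac hK0 hKd hKloc
  have hnn : 0 ≤ hamNorm (fieldWt h (L : ℝ) d k) ((L : ℝ) ^ k) (L ^ (d * k)) H :=
    hamNorm_nonneg (fieldWt_pos hh hL0 d k).le (by positivity) _ H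
  have hb0 : (0 : ℝ) ≤ ∑ Y ∈ polys (L ^ k) X, (∏ _B ∈ blocks (L ^ k) (X \ Y),
      8 * Real.exp (1 / 4) * hamNorm (fieldWt h (L : ℝ) d k) ((L : ℝ) ^ k) (L ^ (d * k)) H) *
      ∏ Z ∈ components Y, C * P.aFactor k Z :=
    sum_nonneg fun Y _ => mul_nonneg (prod_nonneg fun _ _ => by positivity)
      (prod_nonneg fun Z _ => mul_nonneg hC (WeakNormLE.aFactor_pos hA k Z).le)
  exact hS.tayNormLE_fluct hB.dominated hX (P.gauge k X) hb0 (contDiff_polyP2 _ H hKd X)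
    (isGaugeLocal_polyP2_abkm hLodd hM (by omega) hh hp H hKfac hK0 hKloc hX) hP2

/-- **`R_{k+1}P₂(e^{−H},K)(X₂)` is `C^{r₀}`** (torus data, hypotheses of `tayNormLE_fluct_polyP2_abkm`).
[cite: AdamsBuchholzKoteckyMuller2019, Lemma 8.4 / Lemma 9.4] -/
theorem contDiff_fluct_polyP2_abkm_of_stepKernelBounds {L N Mord R n p r₀ : ℕ} {θbar lam μ δ₁ δ₀ A𝒫 A𝒫' C₂ h A : ℝ}
    {𝒞 : ℕ → (Fin d → ZMod M) → ℝ} (hd : 2 ≤ d) (hLodd : Odd L)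
    (hM : M = L ^ N) {k : ℕ} (hkN : k + 1 ≤ N)
    {𝒞q : (Fin d → ZMod M) → ℝ} (hS : StepKernelBounds (abkmWeightData L N Mord R θbar (schedDelta δ₀ δ₁ N) 𝒞) L k A𝒫' C₂ 𝒞q) (hp : d / 2 + 1 ≤ p) (hMord : d / 2 + 1 ≤ Mord)
   
    (hB : AbkmWeightBounds L N Mord R n θbar lam μ δ₁ δ₀ A𝒫 𝒞
      (abkmWeightData L N Mord R θbar (schedDelta δ₀ δ₁ N) 𝒞))
    (hδ₀ : 0 < δ₀) (hδ₁ : 0 < δ₁) (hh : 0 < h) (hh0 : hZeroSq d R δ₀ δ₁ ≤ h ^ 2) (hA : 0 < A)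
    {X : Finset (Fin d → ZMod M)} (hX : IsPolymer (L ^ k) X)
    {H : RelevantHamiltonian ℂ d}
    (hH : hamNorm (fieldWt h (L : ℝ) d k) ((L : ℝ) ^ k) (L ^ (d * k)) H ≤ 1 / 8)
    {K : Finset (Fin d → ZMod M) → ((Fin d → ZMod M) → ℝ) → ℂ} {C : ℝ} (hC : 0 ≤ C)
    (hK : WeakNormLE (abkmNormParams L N Mord R p r₀ h θbar A (schedDelta δ₀ δ₁ N) 𝒞) k K C)
    (hKfac : Factorises (L ^ k) K) (hK0 : ∀ φ, K ∅ φ = 1) (hKd : ∀ Y, ContDiff ℝ r₀ (K Y))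
    (hKloc : ∀ Y, IsPolymer (L ^ k) Y → IsConn Y →
      IsGaugeLocal ((abkmNormParams L N Mord R p r₀ h θbar A (schedDelta δ₀ δ₁ N) 𝒞).gauge k Y) (K Y)) :
    ContDiff ℝ r₀ (fluct 𝒞q (polyP2 (L ^ k) H K X)) := by
  set P := abkmNormParams L N Mord R p r₀ h θbar A (schedDelta δ₀ δ₁ N) 𝒞 with hP
  have hL0 : (0 : ℝ) < L := by exact_mod_cast hLodd.pos
  have hk1 : k + 1 ≤ N + 1 := by omega
  have hP2 := tayNormLE_polyP2_abkm hd hLodd hM hkN hp hMord hB hδ₀ hδ₁ hh hh0 hA hX hH hC hK hKfac hK0 hKd hKloc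
  have hb0 : (0 : ℝ) ≤ ∑ Y ∈ polys (L ^ k) X, (∏ _B ∈ blocks (L ^ k) (X \ Y),
      8 * Real.exp (1 / 4) * hamNorm (fieldWt h (L : ℝ) d k) ((L : ℝ) ^ k) (L ^ (d * k)) H) *
      ∏ Z ∈ components Y, C * P.aFactor k Z := by
    have hnn : 0 ≤ hamNorm (fieldWt h (L : ℝ) d k) ((L : ℝ) ^ k) (L ^ (d * k)) H :=
      hamNorm_nonneg (fieldWt_pos hh hL0 d k).le (by positivity) _ H
    exact sum_nonneg fun Y _ => mul_nonneg (prod_nonneg fun _ _ => by positivity)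
      (prod_nonneg fun Z _ => mul_nonneg hC (WeakNormLE.aFactor_pos hA k Z).le)
  exact hS.contDiff_fluct hB.dominated X (P.gauge k X) hb0 (contDiff_polyP2 _ H hKd X)
    (isGaugeLocal_polyP2_abkm hLodd hM (by omega) hh hp H hKfac hK0 hKloc hX) hP2

/-- **Lipschitz form: `|R_{k+1}P₂(e^{−H},K)(X₂) − R_{k+1}P₂(e^{−H'},K')(X₂)|_{T_k^{X₂*}, w_{k:k+1}^{X₂}}
≤ b'_{P₂} · A_𝒫^{|X₂|_k}`** with the constant `b'_{P₂}` of `PolymerProductLipschitzABKM.tayNormLE_P2_sub_abkm`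
(`‖H‖_{k,0}, ‖H'‖_{k,0} ≤ 1/16`, `‖K‖, ‖K'‖ ≤ C`, `‖K − K'‖ ≤ C_Δ`): `R_{k+1}` is linear on the integrable
functionals `P₂(·)(X₂)(φ + ·)`, then Lemma 8.4 on arbitrary polymers.
[cite: AdamsBuchholzKoteckyMuller2019, Lemma 9.4 / Lemma 9.7 (R₁ is linear) / Lemma 8.4] -/
theorem tayNormLE_fluct_polyP2_sub_abkm_of_stepKernelBounds {L N Mord R n p r₀ : ℕ} {θbar lam μ δ₁ δ₀ A𝒫 A𝒫' C₂ h A : ℝ}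
    {𝒞 : ℕ → (Fin d → ZMod M) → ℝ} (hd : 2 ≤ d) (hLodd : Odd L)
    (hM : M = L ^ N) {k : ℕ} (hkN : k + 1 ≤ N)
    {𝒞q : (Fin d → ZMod M) → ℝ} (hS : StepKernelBounds (abkmWeightData L N Mord R θbar (schedDelta δ₀ δ₁ N) 𝒞) L k A𝒫' C₂ 𝒞q) (hp : d / 2 + 1 ≤ p) (hMord : d / 2 + 1 ≤ Mord)
   
    (hB : AbkmWeightBounds L N Mord R n θbar lam μ δ₁ δ₀ A𝒫 𝒞
      (abkmWeightData L N Mord R θbar (schedDelta δ₀ δ₁ N) 𝒞))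
    (hδ₀ : 0 < δ₀) (hδ₁ : 0 < δ₁) (hh : 0 < h) (hh0 : hZeroSq d R δ₀ δ₁ ≤ h ^ 2) (hA : 0 < A)
    {X : Finset (Fin d → ZMod M)} (hX : IsPolymer (L ^ k) X)
    {H H' : RelevantHamiltonian ℂ d}
    (hH : hamNorm (fieldWt h (L : ℝ) d k) ((L : ℝ) ^ k) (L ^ (d * k)) H ≤ 1 / 16)
    (hH' : hamNorm (fieldWt h (L : ℝ) d k) ((L : ℝ) ^ k) (L ^ (d * k)) H' ≤ 1 / 16)
    {K K' : Finset (Fin d → ZMod M) → ((Fin d → ZMod M) → ℝ) → ℂ} {C CΔ : ℝ} (hC : 0 ≤ C) (hCΔ : 0 ≤ CΔ)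
    (hK : WeakNormLE (abkmNormParams L N Mord R p r₀ h θbar A (schedDelta δ₀ δ₁ N) 𝒞) k K C)
    (hK' : WeakNormLE (abkmNormParams L N Mord R p r₀ h θbar A (schedDelta δ₀ δ₁ N) 𝒞) k K' C)
    (hΔ : WeakNormLE (abkmNormParams L N Mord R p r₀ h θbar A (schedDelta δ₀ δ₁ N) 𝒞) k (K - K') CΔ)
    (hKfac : Factorises (L ^ k) K) (hK0 : ∀ φ, K ∅ φ = 1) (hKd : ∀ Y, ContDiff ℝ r₀ (K Y))
    (hK'fac : Factorises (L ^ k) K') (hK'0 : ∀ φ, K' ∅ φ = 1) (hK'd : ∀ Y, ContDiff ℝ r₀ (K' Y))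
    (hKloc : ∀ Y, IsPolymer (L ^ k) Y → IsConn Y →
      IsGaugeLocal ((abkmNormParams L N Mord R p r₀ h θbar A (schedDelta δ₀ δ₁ N) 𝒞).gauge k Y) (K Y))
    (hK'loc : ∀ Y, IsPolymer (L ^ k) Y → IsConn Y →
      IsGaugeLocal ((abkmNormParams L N Mord R p r₀ h θbar A (schedDelta δ₀ δ₁ N) 𝒞).gauge k Y) (K' Y)) :
    TayNormLE ((abkmNormParams L N Mord R p r₀ h θbar A (schedDelta δ₀ δ₁ N) 𝒞).gauge k X) r₀
      ((abkmWeightData L N Mord R θbar (schedDelta δ₀ δ₁ N) 𝒞).midWeight k X)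
      (fun φ => fluct 𝒞q (polyP2 (L ^ k) H K X) φ - fluct 𝒞q (polyP2 (L ^ k) H' K' X) φ)
      ((∑ Y ∈ polys (L ^ k) X,
        (((∏ _B ∈ blocks (L ^ k) (X \ Y),
            (8 * Real.exp (1 / 4) * hamNorm (fieldWt h (L : ℝ) d k) ((L : ℝ) ^ k) (L ^ (d * k)) H' +
              16 * Real.exp (3 / 8) * hamNorm (fieldWt h (L : ℝ) d k) ((L : ℝ) ^ k) (L ^ (d * k)) (H - H'))) -
          ∏ _B ∈ blocks (L ^ k) (X \ Y),
            8 * Real.exp (1 / 4) * hamNorm (fieldWt h (L : ℝ) d k) ((L : ℝ) ^ k) (L ^ (d * k)) H') *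
          ∏ Z ∈ components Y, C * (abkmNormParams L N Mord R p r₀ h θbar A (schedDelta δ₀ δ₁ N) 𝒞).aFactor k Z +
        (∏ _B ∈ blocks (L ^ k) (X \ Y),
            8 * Real.exp (1 / 4) * hamNorm (fieldWt h (L : ℝ) d k) ((L : ℝ) ^ k) (L ^ (d * k)) H') *
          ((∏ Z ∈ components Y,
              (C * (abkmNormParams L N Mord R p r₀ h θbar A (schedDelta δ₀ δ₁ N) 𝒞).aFactor k Z +
                CΔ * (abkmNormParams L N Mord R p r₀ h θbar A (schedDelta δ₀ δ₁ N) 𝒞).aFactor k Z)) -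
            ∏ Z ∈ components Y, C * (abkmNormParams L N Mord R p r₀ h θbar A (schedDelta δ₀ δ₁ N) 𝒞).aFactor k Z))) *
        A𝒫' ^ numBlocks (L ^ k) X) := by
  set P := abkmNormParams L N Mord R p r₀ h θbar A (schedDelta δ₀ δ₁ N) 𝒞 with hP
  set W := abkmWeightData L N Mord R θbar (schedDelta δ₀ δ₁ N) 𝒞 with hW
  have hL0 : (0 : ℝ) < L := by exact_mod_cast hLodd.pos
  have hk1 : k + 1 ≤ N + 1 := by omega
  have hH8 : hamNorm (fieldWt h (L : ℝ) d k) ((L : ℝ) ^ k) (L ^ (d * k)) H ≤ 1 / 8 := by linarith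
  have hH8' : hamNorm (fieldWt h (L : ℝ) d k) ((L : ℝ) ^ k) (L ^ (d * k)) H' ≤ 1 / 8 := by linarith
  have hnn : ∀ H₀ : RelevantHamiltonian ℂ d,
      0 ≤ hamNorm (fieldWt h (L : ℝ) d k) ((L : ℝ) ^ k) (L ^ (d * k)) H₀ := fun H₀ =>
    hamNorm_nonneg (fieldWt_pos hh hL0 d k).le (by positivity) _ H₀
  -- the difference of the two `P₂`'s and its bound
  have hdiff := tayNormLE_P2_sub_abkm hd hLodd hM hkN hp hMord hB hδ₀ hδ₁ hh hh0 hA hX hH hH' hC hCΔ hK hK' hΔ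
    hKfac hK0 hKd hK'fac hK'0 hK'd hKloc hK'loc
  have hfun : (fun φ => ∑ Y ∈ polys (L ^ k) X, bprod (L ^ k) (fun B => expNegH H B φ - 1) (X \ Y) * K Y φ -
        ∑ Y ∈ polys (L ^ k) X, bprod (L ^ k) (fun B => expNegH H' B φ - 1) (X \ Y) * K' Y φ) =
      fun φ => polyP2 (L ^ k) H K X φ - polyP2 (L ^ k) H' K' X φ := by
    funext φ; rfl
  rw [hfun] at hdiff
  -- nonnegativity of the Lipschitz constant
  have haF : ∀ Z, 0 ≤ P.aFactor k Z := fun Z => (WeakNormLE.aFactor_pos hA k Z).le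
  have hρ0 : (0 : ℝ) ≤ ∑ Y ∈ polys (L ^ k) X,
      (((∏ _B ∈ blocks (L ^ k) (X \ Y),
          (8 * Real.exp (1 / 4) * hamNorm (fieldWt h (L : ℝ) d k) ((L : ℝ) ^ k) (L ^ (d * k)) H' +
            16 * Real.exp (3 / 8) * hamNorm (fieldWt h (L : ℝ) d k) ((L : ℝ) ^ k) (L ^ (d * k)) (H - H'))) -
        ∏ _B ∈ blocks (L ^ k) (X \ Y),
          8 * Real.exp (1 / 4) * hamNorm (fieldWt h (L : ℝ) d k) ((L : ℝ) ^ k) (L ^ (d * k)) H') *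
        ∏ Z ∈ components Y, C * P.aFactor k Z +
      (∏ _B ∈ blocks (L ^ k) (X \ Y),
          8 * Real.exp (1 / 4) * hamNorm (fieldWt h (L : ℝ) d k) ((L : ℝ) ^ k) (L ^ (d * k)) H') *
        ((∏ Z ∈ components Y, (C * P.aFactor k Z + CΔ * P.aFactor k Z)) -
          ∏ Z ∈ components Y, C * P.aFactor k Z)) := by
    have h1 := hnn H'; have h2 := hnn (H - H')
    refine sum_nonneg fun Y _ => add_nonneg (mul_nonneg ?_ ?_) (mul_nonneg ?_ ?_)
    · exact sub_nonneg.2 (prod_le_prod (fun _ _ => by positivity) fun _ _ => by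
        have : (0 : ℝ) ≤ 16 * Real.exp (3 / 8) *
          hamNorm (fieldWt h (L : ℝ) d k) ((L : ℝ) ^ k) (L ^ (d * k)) (H - H') := by positivity
        linarith)
    · exact prod_nonneg fun Z _ => mul_nonneg hC (haF Z)
    · exact prod_nonneg fun _ _ => by positivity
    · exact sub_nonneg.2 (prod_le_prod (fun Z _ => mul_nonneg hC (haF Z)) fun Z _ =>
        le_add_of_nonneg_right (mul_nonneg hCΔ (haF Z)))
  -- smoothness and locality of both `P₂`'s
  have hcd := contDiff_polyP2 (L ^ k) H hKd X
  have hcd' := contDiff_polyP2 (L ^ k) H' hK'd X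
  have hloc := isGaugeLocal_polyP2_abkm (Mord := Mord) (R := R) (r₀ := r₀) (θbar := θbar) (A := A)
    (δ := schedDelta δ₀ δ₁ N) (𝒞 := 𝒞) hLodd hM (by omega : k ≤ N) hh hp H hKfac hK0 hKloc hX
  have hloc' := isGaugeLocal_polyP2_abkm (Mord := Mord) (R := R) (r₀ := r₀) (θbar := θbar) (A := A)
    (δ := schedDelta δ₀ δ₁ N) (𝒞 := 𝒞) hLodd hM (by omega : k ≤ N) hh hp H' hK'fac hK'0 hK'loc hX
  have hlocΔ : IsGaugeLocal (P.gauge k X) (fun φ => polyP2 (L ^ k) H K X φ - polyP2 (L ^ k) H' K' X φ) :=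
    fun φ ψ e => by
      show polyP2 (L ^ k) H K X φ - polyP2 (L ^ k) H' K' X φ = polyP2 (L ^ k) H K X ψ - polyP2 (L ^ k) H' K' X ψ
      rw [hloc φ ψ e, hloc' φ ψ e]
  -- `R` of the difference
  have hR := hS.tayNormLE_fluct hB.dominated hX (P.gauge k X) hρ0 (hcd.sub hcd') hlocΔ hdiff
  -- linearity of `R` on the two integrable functionals
  have hdom := hS.weightSectionDominated hB.dominated X (P.gauge k X)
  have hP2 := tayNormLE_polyP2_abkm hd hLodd hM hkN hp hMord hB hδ₀ hδ₁ hh hh0 hA hX hH8 hC hK hKfac hK0 hKd hKloc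
  have hP2' := tayNormLE_polyP2_abkm hd hLodd hM hkN hp hMord hB hδ₀ hδ₁ hh hh0 hA hX hH8' hC hK' hK'fac hK'0
    hK'd hK'loc
  have hb0 : ∀ H₀ : RelevantHamiltonian ℂ d, (0 : ℝ) ≤ ∑ Y ∈ polys (L ^ k) X, (∏ _B ∈ blocks (L ^ k) (X \ Y),
      8 * Real.exp (1 / 4) * hamNorm (fieldWt h (L : ℝ) d k) ((L : ℝ) ^ k) (L ^ (d * k)) H₀) *
      ∏ Z ∈ components Y, C * P.aFactor k Z := fun H₀ => by
    have := hnn H₀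
    exact sum_nonneg fun Y _ => mul_nonneg (prod_nonneg fun _ _ => by positivity)
      (prod_nonneg fun Z _ => mul_nonneg hC (haF Z))
  have hint : ∀ φ, Integrable (fun ξ => polyP2 (L ^ k) H K X (φ + ξ)) (stepMeasure 𝒞q) :=
    fun φ => integrable_comp_add_of_tayNormLE hP2 (hb0 H) hcd hloc hdom φ
  have hint' : ∀ φ, Integrable (fun ξ => polyP2 (L ^ k) H' K' X (φ + ξ)) (stepMeasure 𝒞q) :=
    fun φ => integrable_comp_add_of_tayNormLE hP2' (hb0 H') hcd' hloc' hdom φ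
  have heq : fluct 𝒞q (fun φ => polyP2 (L ^ k) H K X φ - polyP2 (L ^ k) H' K' X φ) =
      fun φ => fluct 𝒞q (polyP2 (L ^ k) H K X) φ - fluct 𝒞q (polyP2 (L ^ k) H' K' X) φ := by
    funext φ
    unfold fluct
    exact integral_sub (hint φ) (hint' φ)
  rw [heq] at hR
  exact hR

/-- **`R_{k+1}[P₂(e^{−H},K)(X)] = R K(X) + R(e^{−H}−1)^X + R[Σ_{∅≠Y⊊X}(e^{−H}−1)^{X∖Y}K(Y)]`** for a
non-empty `k`-polymer `X` and the torus data (`θ̄, λ > 0`, `AbkmWeightBounds`, `‖H‖_{k,0} ≤ ⅛`,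
`‖K‖_k^{(A)} ≤ C`, `K` factorising with `K(∅) = 1`, local, `C^{r₀}`): the three pieces are integrable
along every section, so the fluctuation integral is additive on them.
[cite: AdamsBuchholzKoteckyMuller2019, Ch. 9.1 (R₁ linear) / Lemma 8.4] -/
theorem fluct_polyP2_eq_add_add_rest_abkm_of_stepKernelBounds {L N Mord R n p r₀ : ℕ} {θbar lam μ δ₁ δ₀ A𝒫 A𝒫' C₂ h A : ℝ}
    {𝒞 : ℕ → (Fin d → ZMod M) → ℝ} (hd : 2 ≤ d) (hLodd : Odd L)
    (hM : M = L ^ N) {k : ℕ} (hkN : k + 1 ≤ N)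
    {𝒞q : (Fin d → ZMod M) → ℝ} (hS : StepKernelBounds (abkmWeightData L N Mord R θbar (schedDelta δ₀ δ₁ N) 𝒞) L k A𝒫' C₂ 𝒞q) (hp : d / 2 + 1 ≤ p) (hMord : d / 2 + 1 ≤ Mord)
   
    (hB : AbkmWeightBounds L N Mord R n θbar lam μ δ₁ δ₀ A𝒫 𝒞
      (abkmWeightData L N Mord R θbar (schedDelta δ₀ δ₁ N) 𝒞))
    (hδ₀ : 0 < δ₀) (hδ₁ : 0 < δ₁) (hh : 0 < h) (hh0 : hZeroSq d R δ₀ δ₁ ≤ h ^ 2) (hA : 0 < A)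
    {X : Finset (Fin d → ZMod M)} (hX : IsPolymer (L ^ k) X) (hXne : X.Nonempty)
    {H : RelevantHamiltonian ℂ d}
    (hH : hamNorm (fieldWt h (L : ℝ) d k) ((L : ℝ) ^ k) (L ^ (d * k)) H ≤ 1 / 8)
    {K : Finset (Fin d → ZMod M) → ((Fin d → ZMod M) → ℝ) → ℂ} {C : ℝ} (hC : 0 ≤ C)
    (hK : WeakNormLE (abkmNormParams L N Mord R p r₀ h θbar A (schedDelta δ₀ δ₁ N) 𝒞) k K C)
    (hKfac : Factorises (L ^ k) K) (hK0 : ∀ φ, K ∅ φ = 1) (hKd : ∀ Y, ContDiff ℝ r₀ (K Y))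
    (hKloc : ∀ Y, IsPolymer (L ^ k) Y → IsConn Y →
      IsGaugeLocal ((abkmNormParams L N Mord R p r₀ h θbar A (schedDelta δ₀ δ₁ N) 𝒞).gauge k Y) (K Y))
    (φ : (Fin d → ZMod M) → ℝ) :
    fluct 𝒞q (polyP2 (L ^ k) H K X) φ =
      fluct 𝒞q (K X) φ + fluct 𝒞q (fun ψ => bprod (L ^ k) (fun B => expNegH H B ψ - 1) X) φ +
        fluct 𝒞q (fun ψ => ∑ Y ∈ ((polys (L ^ k) X).erase X).erase ∅,
          bprod (L ^ k) (fun B => expNegH H B ψ - 1) (X \ Y) * K Y ψ) φ := by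
  set P := abkmNormParams L N Mord R p r₀ h θbar A (schedDelta δ₀ δ₁ N) 𝒞 with hP
  set W := abkmWeightData L N Mord R θbar (schedDelta δ₀ δ₁ N) 𝒞 with hW
  set s := L ^ k with hs
  have hk1 : k + 1 ≤ N + 1 := by omega
  have hkN' : k ≤ N := by omega
  have hL0 : (0 : ℝ) < L := by exact_mod_cast hLodd.pos
  obtain ⟨t, ht⟩ : ∃ t, N = k + t := ⟨N - k, by omega⟩
  have hMt : M = s * L ^ t := by rw [hs, ← pow_add, ← ht]; exact hM
  have htodd : Odd (L ^ t) := hLodd.pow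
  have hsodd : Odd s := hLodd.pow
  have h𝔥 : 0 < P.𝔥 k := fieldWt_pos hh hL0 d k
  have hR : 0 < P.R k := by show (0 : ℝ) < (L : ℝ) ^ k; positivity
  have hdom := hS.weightSectionDominated hB.dominated X (P.gauge k X)
  have hnn : 0 ≤ hamNorm (fieldWt h (L : ℝ) d k) ((L : ℝ) ^ k) (L ^ (d * k)) H :=
    hamNorm_nonneg (fieldWt_pos hh hL0 d k).le (by positivity) _ H
  have haF : ∀ Z, 0 ≤ P.aFactor k Z := fun Z => (WeakNormLE.aFactor_pos hA k Z).le
  -- (1) `K(X)`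
  have hK1 := tayNormLE_apply_abkm (p := p) hLodd hM hkN' hB hA hX hC hK hKfac hK0 hKd hKloc
  have hK1loc : IsGaugeLocal (P.gauge k X) (K X) :=
    isGaugeLocal_of_factorises_polys hMt hsodd htodd hKfac hK0 hKloc hX
  have hiK : Integrable (fun ξ => K X (φ + ξ)) (stepMeasure 𝒞q) :=
    integrable_comp_add_of_tayNormLE hK1 (prod_nonneg fun Z _ => mul_nonneg hC (haF Z)) (hKd X) hK1loc hdom φ
  -- (2) `(e^{−H}−1)^X`
  have hE := tayNormLE_bprod_expNegH_sub_one_abkm (p := p) (r₀ := r₀) (A := A) hd hLodd hM hkN hp hMord hB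
    hδ₀ hδ₁ hh hh0 hX hH
  have hEd : ContDiff ℝ r₀ (fun ψ => bprod s (fun B => expNegH H B ψ - 1) X) := by
    unfold TorusPolymer.bprod
    exact contDiff_prod fun B _ => ((contDiff_eval H B (n := r₀)).neg.cexp).sub contDiff_const
  have hEloc : IsGaugeLocal (P.gauge k X) (fun ψ => bprod s (fun B => expNegH H B ψ - 1) X) := by
    unfold TorusPolymer.bprod
    refine IsGaugeLocal.prod _ fun B hB => ?_
    have hloc : IsGaugeLocal (P.gauge k B) (fun ψ : (Fin d → ZMod M) → ℝ => expNegH H B ψ - 1) :=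
      IsGaugeLocal.op₁ _ (fun z : ℂ => z - 1) (isGaugeLocal_cexp_neg_eval h𝔥.ne' hR.ne' hp
        (TorusPolymer.subset_thicken _ _) H)
    exact hloc.of_norm_le fun ξ =>
      norm_fieldGauge_mono_set _ _ _ (TorusPolymer.thicken_mono _ (hX.subset_of_mem_blocks hB)) ξ
  have hiE : Integrable (fun ξ => bprod s (fun B => expNegH H B (φ + ξ) - 1) X) (stepMeasure 𝒞q) :=
    integrable_comp_add_of_tayNormLE hE (prod_nonneg fun _ _ => by positivity) hEd hEloc hdom φ
  -- (3) the rest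
  set 𝓨 := ((polys s X).erase X).erase ∅ with h𝓨
  have h𝓨sub : 𝓨 ⊆ polys s X := (erase_subset _ _).trans (erase_subset _ _)
  have hRst := tayNormLE_polyP2Rest_abkm hd hLodd hM hkN hp hMord hB hδ₀ hδ₁ hh hh0 hA hX h𝓨sub hH hC hK
    hKfac hK0 hKd hKloc
  have hRd : ContDiff ℝ r₀ (fun ψ => ∑ Y ∈ 𝓨, bprod s (fun B => expNegH H B ψ - 1) (X \ Y) * K Y ψ) := by
    refine ContDiff.sum fun Y _ => ContDiff.mul ?_ (hKd Y)
    unfold TorusPolymer.bprod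
    exact contDiff_prod fun B _ => ((contDiff_eval H B (n := r₀)).neg.cexp).sub contDiff_const
  have hRloc : IsGaugeLocal (P.gauge k X)
      (fun ψ => ∑ Y ∈ 𝓨, bprod s (fun B => expNegH H B ψ - 1) (X \ Y) * K Y ψ) := by
    -- the rest is `P₂(X) − K(X) − (e^{−H}−1)^X`, all three local
    have hP2loc := isGaugeLocal_polyP2_abkm (Mord := Mord) (R := R) (r₀ := r₀) (θbar := θbar) (A := A)
      (δ := schedDelta δ₀ δ₁ N) (𝒞 := 𝒞) hLodd hM hkN' hh hp H hKfac hK0 hKloc hX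
    intro ψ ψ' e
    have h1 := hP2loc ψ ψ' e
    have h2 := hK1loc ψ ψ' e
    have h3 := hEloc ψ ψ' e
    rw [polyP2_eq_add_add_rest H hK0 hX hXne ψ, polyP2_eq_add_add_rest H hK0 hX hXne ψ'] at h1
    simp only at h3
    show ∑ Y ∈ 𝓨, bprod s (fun B => expNegH H B ψ - 1) (X \ Y) * K Y ψ =
      ∑ Y ∈ 𝓨, bprod s (fun B => expNegH H B ψ' - 1) (X \ Y) * K Y ψ'
    have := congrArg (fun z => z - K X ψ - bprod s (fun B => expNegH H B ψ - 1) X) h1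
    rw [h2, h3] at this
    have e4 : ∑ Y ∈ 𝓨, bprod s (fun B => expNegH H B ψ - 1) (X \ Y) * K Y ψ =
        K X ψ' + bprod s (fun B => expNegH H B ψ' - 1) X +
          ∑ Y ∈ 𝓨, bprod s (fun B => expNegH H B ψ - 1) (X \ Y) * K Y ψ - K X ψ' -
          bprod s (fun B => expNegH H B ψ' - 1) X := by ring
    rw [e4, this]; ring
  have hiR : Integrable (fun ξ => ∑ Y ∈ 𝓨, bprod s (fun B => expNegH H B (φ + ξ) - 1) (X \ Y) * K Y (φ + ξ))
      (stepMeasure 𝒞q) :=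
    integrable_comp_add_of_tayNormLE hRst (sum_nonneg fun Y _ => mul_nonneg (prod_nonneg fun _ _ => by positivity)
      (prod_nonneg fun Z _ => mul_nonneg hC (haF Z))) hRd hRloc hdom φ
  -- assemble
  unfold fluct
  have hsplit : ∀ ξ, polyP2 s H K X (φ + ξ) = K X (φ + ξ) + bprod s (fun B => expNegH H B (φ + ξ) - 1) X +
      ∑ Y ∈ 𝓨, bprod s (fun B => expNegH H B (φ + ξ) - 1) (X \ Y) * K Y (φ + ξ) := fun ξ =>
    polyP2_eq_add_add_rest H hK0 hX hXne (φ + ξ)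
  simp_rw [hsplit]
  have hiKE : Integrable (fun ξ => K X (φ + ξ) + bprod s (fun B => expNegH H B (φ + ξ) - 1) X)
      (stepMeasure 𝒞q) := hiK.add hiE
  rw [integral_add hiKE hiR, integral_add hiK hiE]

end Literature.MathematicalPhysics.StatisticalMechanics.GradientRG

end
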